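import Literature.AlgebraicGeometry.AbelianSchemes.SerreTensorFrobeniusTwist
import Literature.AlgebraicGeometry.AbelianSchemes.AbelianSchemeHomDescentKernelEq
import Literature.AlgebraicGeometry.Motives.AbelianVarietyFrobeniusFactor
import HarnessLib

/-!
# (ST-2F-T) The tangent criterion for the Serre translate: `𝔭 · T_e(A) = 0 ⇒ ψ_P = F_{A/k,p} ≫ g ⇒ Ker F ⊆ A[𝔭]`

Topic `Literature/AlgebraicGeometry/AbelianSchemes`, namespace `Literature.AlgebraicGeometry.AbelianSchemes.AbelianSchemeOver` (THEOREMS ONLY; no definition, no named fact,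
no `sorry`, no `instance`, no notation).  Cell `hodgecm-mathlib`, F0/P6 «MOD», sequel to ★ (ST-2F) `SerreTensorFrobeniusTwist` and ★ (KER-EQ)
`AbelianSchemeHomDescentKernelEq`, supplying the HYPOTHESIS of ★ (ST-2F) (R2) (`Ker F ⊆ A[𝔭]`) from the Lie-algebra ∕ CM-type condition at `𝔭` — Shimura's «`δλ̃ = 0` ⇒
`λ̃` factors through the `p`-th power homomorphism» (★ `exists_eq_relFrobenius_comp_of_forall_tangent_comp_eq_one`) applied to `λ̃ := ψ_P`; `--supports
stmt-HodgeConjecture-24832`, count-neutral.  HC_CM is proved only modulo the 2 remaining named inputs (hLiu418, h413) until rung 0 closes; this file discharges none of them.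

## Mathematics

`k` PERFECT of characteristic `p` (prime), `A/k` an abelian variety with `𝒪`-action `ι` on `A₀ = (ofAbelianVariety A).toOver`, `ψ_P : A → A ⊗_𝒪 𝔟` the Serre translate of an
ideal `𝔭 = (P₁,…,P_m)` (★ (A) `SerreTensorIdealTranslationKernel`), `F = F_{A/k,p} : A → A^{(p)}` (★ `relFrobeniusHom p 1 A`).  HYPOTHESIS «`𝔭` KILLS THE TANGENT SPACE»:
every `K(A)[ε]`-valued tangent vector `t` of `A` at the origin satisfies `ι(a) t = 1` for all `a ∈ 𝔭` (the reading of `𝔭 · Lie(A) = 0` used by the ★ criterion; at a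
place where the CM type ∕ Kottwitz signature puts all of `Lie A` in the `𝔭`-eigenspace killed by `𝔭`).  THEN: §1 `ψ_P` kills every such tangent vector (★
`comp_serreTranslate_eq_one_of_forall_mem`), so `ψ_P = F ≫ g` for a homomorphism `g : A^{(p)} → A ⊗_𝒪 𝔟` of abelian varieties (★ Shimura §2.8 Prop. 6 ∕ §18.6); §2 hence
`Ker F ⊆ Ker ψ_P = A[𝔭]` on ALL points: `t ≫ F = 1 → ∀ a ∈ 𝔭, ι(a) t = 1`; §3 consequently ★ (ST-2F) (R2) applies with only the RANK hypothesis left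
(`rk ψ_P ≡ p^{dim A}`): `A^{(p)} ≅ A ⊗_𝒪 𝔟` under `A`, `F ↦ ψ_P`, `𝒪`-equivariantly; and if moreover `A[𝔭] ⊆ Ker F` then no rank is needed (★ KER-EQ).

## Contents

* §1 `forall_tangent_comp_serreTranslate_eq_one`, **`exists_serreTranslate_eq_relFrobeniusHom_comp`** (`ψ_P = F ≫ g`, `g` the scheme map of a homomorphism of abelian varieties).
* §2 **`forall_mem_comp_i_eq_one_of_comp_relFrobeniusHom_eq_one`** (`Ker F_{A/k,p} ⊆ A[𝔭]`).
* §3 **`exists_iso_relFrobenius_comp_eq_serreTranslate_of_tangent`** (rank form), **`exists_iso_relFrobenius_comp_eq_serreTranslate_of_tangent_of_forall`** (rank-free form,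
  given also `A[𝔭] ⊆ Ker F`).

## References
* [Shimura1998] G. Shimura, *Abelian Varieties with Complex Multiplication and Modular Functions* (1998), §2.8 Prop. 6 (p. 16), §13.1 Thm. 1 (pp. 97–99), §18.6 (pp. 127–129).
* [MilneCM2006] J. S. Milne, *Complex Multiplication* (2006), §7 (Prop. 7.22, Rem. 7.23), §8 (Thm. 8.1, the Shimura–Taniyama formula).
* [MumfordAV1970] D. Mumford, *Abelian Varieties* (1970), §7 Thm. 4 (p. 72), §15 (p. 146).
* [Kottwitz1992] R. Kottwitz, JAMS 5 (1992), §5 (p. 390) (determinant ∕ Lie-algebra condition).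
* Tree: ★ `SerreTensorFrobeniusTwist` (ST-2F), ★ `AbelianSchemeHomDescentKernelEq` (KER-EQ), ★ `AbelianVarietyFrobeniusFactor`, ★ `SerreTensorIdealTranslationKernel` (A).
-/

noncomputable section

universe u

open CategoryTheory CategoryTheory.Limits AlgebraicGeometry MonoidalCategory CartesianMonoidalCategory
open scoped MonObj

namespace Literature.AlgebraicGeometry.AbelianSchemes

namespace AbelianSchemeOver

open Literature.AlgebraicGeometry.Motives Literature.AlgebraicGeometry.Motives.AbelianVariety AlgPoints

variable {k : Type u} [Field k] [PerfectField k] (p : ℕ) [Fact p.Prime] [ExpChar k p] {A : AbelianVariety k} {O : Type*} [CommRing O]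
  (act : (AbelianScheme.ofAbelianVariety A).toOver.RingAction O) [IsCommMonObj (AbelianScheme.ofAbelianVariety A).toOver.X]
  {m : ℕ} (E' : Matrix (Fin m) (Fin m) O) (hE' : E' * E' = E') (P : Matrix (Fin m) (Fin 1) O) (Q : Matrix (Fin 1) (Fin m) O) {N : ℕ}
  [IsMonHom (serreTranslate act E' hE' P)] [IsMonHom (relFrobeniusHom p 1 A)]

/-! ## §1 `ψ_P` kills the tangent vectors, hence factors through `F_{A/k,p}` -/

omit [PerfectField k] [Fact p.Prime] [ExpChar k p] [IsMonHom (serreTranslate act E' hE' P)] [IsMonHom (relFrobeniusHom p 1 A)] in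
/-- If `𝔭` kills every `K(A)[ε]`-valued tangent vector of `A` at the origin, so does `ψ_P` (★ `comp_serreTranslate_eq_one_of_forall_mem`).
[cite: Shimura1998, §18.6 (pp. 127–129)] [cite: MilneCM2006, §7 (Prop. 7.22, Rem. 7.23)] -/
theorem forall_tangent_comp_serreTranslate_eq_one (hP : E' * P = P) {𝔭 : Ideal O} (h𝔭 : Ideal.span (Set.range fun k => P k 0) = 𝔭)
    (htan : ∀ t : specOver k (DualNumber A.X.left.functionField) ⟶ A.X,
      AlgPoints.specOverMapOfAlgHom (TrivSqZeroExt.fstHom k A.X.left.functionField A.X.left.functionField) ≫ t = 1 →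
        ∀ a ∈ 𝔭, t ≫ act.i a = 1)
    (t : specOver k (DualNumber A.X.left.functionField) ⟶ A.X)
    (ht : AlgPoints.specOverMapOfAlgHom (TrivSqZeroExt.fstHom k A.X.left.functionField A.X.left.functionField) ≫ t = 1) :
    t ≫ serreTranslate act E' hE' P = 1 :=
  comp_serreTranslate_eq_one_of_forall_mem act E' hE' P hP h𝔭 t (htan t ht)

omit [IsMonHom (relFrobeniusHom p 1 A)] in
/-- **`ψ_P = F_{A/k,p} ≫ g`**: if `𝔭` kills the `K(A)[ε]`-valued tangent vectors of `A` at the origin (`k` perfect of characteristic `p`), the Serre translate `ψ_P` factors through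
the relative `p`-Frobenius: `ψ_P = F ≫ g` with `g` the scheme map of a homomorphism `A^{(p)} → A ⊗_𝒪 𝔟` of abelian varieties (Shimura §2.8 Prop. 6 ∕ §18.6 «`π = ψ ∘ λ̃`», ★
`exists_eq_relFrobenius_comp_of_forall_tangent_comp_eq_one` applied to `ψ_P` packaged as a homomorphism of abelian varieties).
[cite: Shimura1998, §2.8 Prop. 6 (p. 16); §18.6 (pp. 127–129)] -/
theorem exists_serreTranslate_eq_relFrobeniusHom_comp (hP : E' * P = P) {𝔭 : Ideal O} (h𝔭 : Ideal.span (Set.range fun k => P k 0) = 𝔭)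
    (htan : ∀ t : specOver k (DualNumber A.X.left.functionField) ⟶ A.X,
      AlgPoints.specOverMapOfAlgHom (TrivSqZeroExt.fstHom k A.X.left.functionField A.X.left.functionField) ≫ t = 1 →
        ∀ a ∈ 𝔭, t ≫ act.i a = 1) :
    ∃ g : A.frobeniusTwist p 1 ⟶ (serreTensor act E' hE').toAffine.toAbelianVariety,
      serreTranslate act E' hE' P = relFrobeniusHom p 1 A ≫ g.hom.hom.hom := by
  -- `ψ_P` as a homomorphism of abelian varieties `A ⟶ (A ⊗_𝒪 𝔟)` (the `IsMonHom` fields are supplied by name: the group-object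
  -- instances of `A.toGrp.X` and of `A₀.X` agree only semireducibly)
  obtain ⟨g, hg⟩ := exists_eq_relFrobenius_comp_of_forall_tangent_comp_eq_one p
    (InducedCategory.homMk (Grp.homMk'' (A := A.toGrp) (B := ((serreTensor act E' hE').toAffine.toAbelianVariety).toGrp)
      (serreTranslate act E' hE' P) ‹IsMonHom (serreTranslate act E' hE' P)›.one_hom ‹IsMonHom (serreTranslate act E' hE' P)›.mul_hom) :
      A ⟶ (serreTensor act E' hE').toAffine.toAbelianVariety)
    (fun t ht => forall_tangent_comp_serreTranslate_eq_one act E' hE' P hP h𝔭 htan t ht)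
  exact ⟨g, congrArg (fun φ : A ⟶ (serreTensor act E' hE').toAffine.toAbelianVariety => φ.hom.hom.hom) hg⟩

/-! ## §2 Hence `Ker F_{A/k,p} ⊆ A[𝔭]` on all points -/

omit [IsMonHom (relFrobeniusHom p 1 A)] in
include hE' in
/-- **`Ker F_{A/k,p} ⊆ A[𝔭]`**: under the tangent hypothesis, every point `t` of `A` with `t ≫ F = 1` satisfies `ι(a) t = 1` for all `a ∈ 𝔭` (`ψ_P = F ≫ g` kills `t`, and `ψ_P` kills
exactly `A[𝔭]`, ★ `comp_serreTranslate_eq_one_iff_forall_mem`) — the hypothesis `hker` of ★ (ST-2F) (R2). [cite: Shimura1998, §13.1 Thm. 1 (pp. 97–99)]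
[cite: MilneCM2006, §7 (Prop. 7.22, Rem. 7.23)] -/
theorem forall_mem_comp_i_eq_one_of_comp_relFrobeniusHom_eq_one (hP : E' * P = P) {𝔭 : Ideal O}
    (h𝔭 : Ideal.span (Set.range fun k => P k 0) = 𝔭)
    (htan : ∀ t : specOver k (DualNumber A.X.left.functionField) ⟶ A.X,
      AlgPoints.specOverMapOfAlgHom (TrivSqZeroExt.fstHom k A.X.left.functionField A.X.left.functionField) ≫ t = 1 →
        ∀ a ∈ 𝔭, t ≫ act.i a = 1)
    ⦃T : Over (Spec (.of k))⦄ (t : T ⟶ (AbelianScheme.ofAbelianVariety A).toOver.X) (ht : t ≫ relFrobeniusHom p 1 A = 1) :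
    ∀ a ∈ 𝔭, t ≫ act.i a = 1 := by
  obtain ⟨g, hg⟩ := exists_serreTranslate_eq_relFrobeniusHom_comp p act E' hE' P hP h𝔭 htan
  -- `g` is a homomorphism for the group structures of the abelian `k`-schemes (semireducibly those of the abelian varieties)
  haveI : IsMonHom (M := (AbelianScheme.ofAbelianVariety (A.frobeniusTwist p 1)).toOver.X) (N := (serreTensor act E' hE').X) g.hom.hom.hom :=
    inferInstanceAs (IsMonHom g.hom.hom.hom)
  have hψ : t ≫ serreTranslate act E' hE' P = 1 :=
    comp_eq_one_of_comp_eq (AbelianScheme.ofAbelianVariety A).toOver (relFrobeniusHom p 1 A) (serreTranslate act E' hE' P)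
      (χ := g.hom.hom.hom) hg.symm t ht
  exact (comp_serreTranslate_eq_one_iff_forall_mem act E' hE' P hP h𝔭 t).1 hψ

/-! ## §3 The Frobenius twist is the Serre tensor under the tangent hypothesis -/

omit [IsMonHom (relFrobeniusHom p 1 A)] in
/-- **(ST-2F-T, rank form)**: `k` perfect of characteristic `p`, `𝔭` kills the tangent space of `A`, and `rk ψ_P ≡ p^{dim A}` (with the quasi-inverse row `Q`, `N ≠ 0`, as in ★ (A)).
Then there is a unique `e : A^{(p)} ≅ A ⊗_𝒪 𝔟` with `F ≫ e = ψ_P`, a homomorphism, `𝒪`-equivariant (★ (ST-2F) (R2) fed by §2).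
[cite: Shimura1998, §13.1 Thm. 1 (pp. 97–99)] [cite: MilneCM2006, §8 (Thm. 8.1)] [cite: MumfordAV1970, §7 Thm. 4 (p. 72)] -/
theorem exists_iso_relFrobenius_comp_eq_serreTranslate_of_tangent (hN : N ≠ 0) (hP : E' * P = P) (hQ : Q * E' = Q)
    (hQP : Q * P = Matrix.scalar (Fin 1) (N : O)) (hPQ : P * Q = Matrix.scalar (Fin m) (N : O) * E')
    {𝔭 : Ideal O} (h𝔭 : Ideal.span (Set.range fun k => P k 0) = 𝔭)
    (htan : ∀ t : specOver k (DualNumber A.X.left.functionField) ⟶ A.X,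
      AlgPoints.specOverMapOfAlgHom (TrivSqZeroExt.fstHom k A.X.left.functionField A.X.left.functionField) ≫ t = 1 →
        ∀ a ∈ 𝔭, t ≫ act.i a = 1)
    (hdψ : ∀ c : (serreTensor act E' hE').left, (serreTranslate act E' hE' P).left.finrank c = p ^ (1 * A.dim)) :
    ∃ e : (AbelianScheme.ofAbelianVariety (A.frobeniusTwist p 1)).toOver.X ≅ (serreTensor act E' hE').X,
      relFrobeniusHom p 1 A ≫ e.hom = serreTranslate act E' hE' P ∧ IsMonHom e.hom ∧
        (∀ a, (act.frobeniusTwist p 1).i a ≫ e.hom = e.hom ≫ (serreAction act E' hE').i a) ∧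
          ∀ χ : (AbelianScheme.ofAbelianVariety (A.frobeniusTwist p 1)).toOver.X ⟶ (serreTensor act E' hE').X,
            relFrobeniusHom p 1 A ≫ χ = serreTranslate act E' hE' P → χ = e.hom :=
  exists_iso_relFrobenius_comp_eq_serreTranslate_of_perfectField p 1 act E' hE' P Q hN hP hQ hQP hPQ h𝔭
    (forall_mem_comp_i_eq_one_of_comp_relFrobeniusHom_eq_one p act E' hE' P hP h𝔭 htan) hdψ

/-- **(ST-2F-T, rank-free form)**: if `𝔭` kills the tangent space of `A` AND `A[𝔭] ⊆ Ker F_{A/k,p}` on points, then `Ker F = A[𝔭]` and `A^{(p)} ≅ A ⊗_𝒪 𝔟` under `A`, `F ↦ ψ_P`,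
`𝒪`-equivariantly, uniquely — with no degree count (★ KER-EQ; `ψ_P` fppf by ★ (A), `F` fppf by ★ (ST-2F) §1). [cite: Shimura1998, §13.1 Thm. 1 (pp. 97–99)]
[cite: MumfordAV1970, §7 Thm. 4 (p. 72)] -/
theorem exists_iso_relFrobenius_comp_eq_serreTranslate_of_tangent_of_forall (hN : N ≠ 0) (hP : E' * P = P) (hQ : Q * E' = Q)
    (hQP : Q * P = Matrix.scalar (Fin 1) (N : O)) (hPQ : P * Q = Matrix.scalar (Fin m) (N : O) * E')
    {𝔭 : Ideal O} (h𝔭 : Ideal.span (Set.range fun k => P k 0) = 𝔭)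
    (htan : ∀ t : specOver k (DualNumber A.X.left.functionField) ⟶ A.X,
      AlgPoints.specOverMapOfAlgHom (TrivSqZeroExt.fstHom k A.X.left.functionField A.X.left.functionField) ≫ t = 1 →
        ∀ a ∈ 𝔭, t ≫ act.i a = 1)
    (hker : ∀ ⦃T : Over (Spec (.of k))⦄ (t : T ⟶ (AbelianScheme.ofAbelianVariety A).toOver.X),
      (∀ a ∈ 𝔭, t ≫ act.i a = 1) → t ≫ relFrobeniusHom p 1 A = 1) :
    ∃ e : (AbelianScheme.ofAbelianVariety (A.frobeniusTwist p 1)).toOver.X ≅ (serreTensor act E' hE').X,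
      relFrobeniusHom p 1 A ≫ e.hom = serreTranslate act E' hE' P ∧ IsMonHom e.hom ∧
        (∀ a, (act.frobeniusTwist p 1).i a ≫ e.hom = e.hom ≫ (serreAction act E' hE').i a) ∧
          ∀ χ : (AbelianScheme.ofAbelianVariety (A.frobeniusTwist p 1)).toOver.X ⟶ (serreTensor act E' hE').X,
            relFrobeniusHom p 1 A ≫ χ = serreTranslate act E' hE' P → χ = e.hom := by
  haveI := isFinite_relFrobeniusHom_left p 1 A
  haveI := flat_relFrobeniusHom_left p 1 A
  haveI := surjective_relFrobeniusHom_left p 1 A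
  haveI := isFinite_serreTranslate_left act E' hE' P Q hN hP hQ hQP hPQ
  haveI := flat_serreTranslate_left act E' hE' P Q hN hP hQ hQP hPQ
  haveI := surjective_serreTranslate_left act E' hE' P Q hN hP hQ hQP hPQ
  refine exists_iso_comp_eq_equivariant_of_comp_eq_one_iff (relFrobeniusHom p 1 A) (serreTranslate act E' hE' P) act
    (serreAction act E' hE') (act.frobeniusTwist p 1) (RingAction.i_comp_relFrobeniusHom p 1 act) (i_comp_serreTranslate act E' hE' P hP)
    fun T t => ⟨fun ht => ?_, fun ht => hker t ((comp_serreTranslate_eq_one_iff_forall_mem act E' hE' P hP h𝔭 t).1 ht)⟩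
  exact comp_serreTranslate_eq_one_of_forall_mem act E' hE' P hP h𝔭 t
    (forall_mem_comp_i_eq_one_of_comp_relFrobeniusHom_eq_one p act E' hE' P hP h𝔭 htan t ht)

end AbelianSchemeOver

end Literature.AlgebraicGeometry.AbelianSchemes

end
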